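import Mathlib.Data.Real.Basic
import Mathlib.Tactic.Positivity
import Mathlib.Tactic.Ring
import Mathlib.Tactic.Linarith
import HarnessLib

/-!
# `K₄` is Potts–Rayleigh for `0 < q ≤ 1` — file 1: the two polynomial certificates

Support file (`--supports stmt-CriticalPhenomena-4575`), FK sub-lane `prim-bschramm-fk-3` (gen 6) of the post-continuity
programme; builds on p205010 (kernel theorem, internal audit signed; external expert review pending).  Pure real algebra; no
sorries; standard axioms.

Edge-negative association of the random-cluster measure `φ_{w,q}` (`0 < q ≤ 1`) on the complete graph `K₄` — "`K₄` is
Potts–Rayleigh", Wagner 2008 Example 5.2 (a computation attributed to Sokal; `K₄` is the first graph outside the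
series–parallel class of Wagner's Theorem 5.8) — reduces by the master identity `FK.negCorr_defect_eq` of
`…AllQEdgeToggle.lean` to the sign of the bracket `S₀₀(x ↮ y)·Z₀₁ − S₀₁(x ↮ y)·Z₀₀` for the "diamond" `K₄ − e`, with the
second pair `f` deleted (`₀₀`) or contracted (`₀₁`), in the two positions of `f` relative to `e = xy`: DISJOINT (`e = 01`,
`f = 23`, free parameters `a, b, c, d` on `02, 03, 12, 13`) and ADJACENT (`e = 01`, `f = 02`, free parameters on
`03, 12, 13, 23`).  This file records the four masses of each case as explicit polynomials (identified with the random-cluster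
masses in `…FKRayleighK4Masses.lean`) and proves the two brackets nonnegative on `[0,1]⁴ × [0,1]` by EXPLICIT
CERTIFICATES found by this seat (exact rational arithmetic, bschramm/FK-BARRIER.md §10):
* adjacent case: the bracket is a nonnegative combination of products `Π_e p_e^{α_e}(1−p_e)^{2−α_e} · q^{3+i}(1−q)^{3−i}`;
* disjoint case: the bracket equals `q³·(b c (1−a)(1−d) − a d (1−b)(1−c))²` plus such a nonnegative combination —
  Wagner's remark that `ΔZ{e,f} ≫ (y_b y_c − y_a y_d)²` coefficientwise in the odds variables `y = p/(1−p)` while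
  `ΔZ{e,f}` itself is NOT coefficientwise nonnegative (the monomial `y_a y_b y_c y_d` carries `q² + 3q − 2`).
[cite: Wagner2006, Ex. 5.2, Thm. 5.8] [cite: Grimmett2006, §3.9 eq. (3.94) (p. 63); §1.4 eq. (1.20) (p. 15)]
-/

noncomputable section

namespace Summit.CriticalPhenomena.PercolationContinuityZ3.Theorems

namespace FK

namespace RayleighK4

/-- The mass `S₀₀(0 ↮ 1)` of the disjoint case (`e = 01` absent, `f = 23` deleted; parameters `a, b, c, d` on `02, 03, 12, 13`). (transcription of this seat's exact enumeration, bschramm/FK-BARRIER.md §10) -/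
def s00Disj (a b c d q : ℝ) : ℝ :=
  q ^ 4 + d * q ^ 3 - d * q ^ 4 + c * q ^ 3 - c * q ^ 4 + c * d * q ^ 2 - 2 * c * d * q ^ 3 + c * d * q ^ 4 + b * q ^ 3
      - b * q ^ 4 - 2 * b * d * q ^ 3 + b * d * q ^ 4 + b * c * q ^ 2 - 2 * b * c * q ^ 3 + b * c * q ^ 4 - 2 * b * c * d * q ^ 2
      + 3 * b * c * d * q ^ 3 - b * c * d * q ^ 4 + a * q ^ 3 - a * q ^ 4 + a * d * q ^ 2 - 2 * a * d * q ^ 3 + a * d * q ^ 4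
      - 2 * a * c * q ^ 3 + a * c * q ^ 4 - 2 * a * c * d * q ^ 2 + 3 * a * c * d * q ^ 3 - a * c * d * q ^ 4 + a * b * q ^ 2
      - 2 * a * b * q ^ 3 + a * b * q ^ 4 - 2 * a * b * d * q ^ 2 + 3 * a * b * d * q ^ 3 - a * b * d * q ^ 4 - 2 * a * b * c * q ^ 2
      + 3 * a * b * c * q ^ 3 - a * b * c * q ^ 4 + 4 * a * b * c * d * q ^ 2 - 4 * a * b * c * d * q ^ 3 + a * b * c * d * q ^ 4

/-- The partition function `Z₀₀` of the disjoint case (`e = 01` absent, `f = 23` deleted; parameters `a, b, c, d` on `02, 03, 12, 13`). (transcription of this seat's exact enumeration, bschramm/FK-BARRIER.md §10) -/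
def z00Disj (a b c d q : ℝ) : ℝ :=
  q ^ 4 + d * q ^ 3 - d * q ^ 4 + c * q ^ 3 - c * q ^ 4 + c * d * q ^ 2 - 2 * c * d * q ^ 3 + c * d * q ^ 4 + b * q ^ 3
      - b * q ^ 4 + b * d * q ^ 2 - 2 * b * d * q ^ 3 + b * d * q ^ 4 + b * c * q ^ 2 - 2 * b * c * q ^ 3 + b * c * q ^ 4
      + b * c * d * q - 3 * b * c * d * q ^ 2 + 3 * b * c * d * q ^ 3 - b * c * d * q ^ 4 + a * q ^ 3 - a * q ^ 4 + a * d * q ^ 2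
      - 2 * a * d * q ^ 3 + a * d * q ^ 4 + a * c * q ^ 2 - 2 * a * c * q ^ 3 + a * c * q ^ 4 + a * c * d * q - 3 * a * c * d * q ^ 2
      + 3 * a * c * d * q ^ 3 - a * c * d * q ^ 4 + a * b * q ^ 2 - 2 * a * b * q ^ 3 + a * b * q ^ 4 + a * b * d * q
      - 3 * a * b * d * q ^ 2 + 3 * a * b * d * q ^ 3 - a * b * d * q ^ 4 + a * b * c * q - 3 * a * b * c * q ^ 2 + 3 * a * b * c * q ^ 3
      - a * b * c * q ^ 4 - 3 * a * b * c * d * q + 6 * a * b * c * d * q ^ 2 - 4 * a * b * c * d * q ^ 3 + a * b * c * d * q ^ 4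

/-- The mass `S₀₁(0 ↮ 1)` of the disjoint case (`e = 01` absent, `f = 23` contracted, i.e. parameter 1; parameters `a, b, c, d` on `02, 03, 12, 13`). (transcription of this seat's exact enumeration, bschramm/FK-BARRIER.md §10) -/
def s01Disj (a b c d q : ℝ) : ℝ :=
  q ^ 3 + d * q ^ 2 - d * q ^ 3 + c * q ^ 2 - c * q ^ 3 - c * d * q ^ 2 + c * d * q ^ 3 + b * q ^ 2 - b * q ^ 3 - 2 * b * d * q ^ 2
      + b * d * q ^ 3 - 2 * b * c * q ^ 2 + b * c * q ^ 3 + 2 * b * c * d * q ^ 2 - b * c * d * q ^ 3 + a * q ^ 2 - a * q ^ 3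
      - 2 * a * d * q ^ 2 + a * d * q ^ 3 - 2 * a * c * q ^ 2 + a * c * q ^ 3 + 2 * a * c * d * q ^ 2 - a * c * d * q ^ 3
      - a * b * q ^ 2 + a * b * q ^ 3 + 2 * a * b * d * q ^ 2 - a * b * d * q ^ 3 + 2 * a * b * c * q ^ 2 - a * b * c * q ^ 3
      - 2 * a * b * c * d * q ^ 2 + a * b * c * d * q ^ 3

/-- The partition function `Z₀₁` of the disjoint case (`e = 01` absent, `f = 23` contracted; parameters `a, b, c, d` on `02, 03, 12, 13`). (transcription of this seat's exact enumeration, bschramm/FK-BARRIER.md §10) -/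
def z01Disj (a b c d q : ℝ) : ℝ :=
  q ^ 3 + d * q ^ 2 - d * q ^ 3 + c * q ^ 2 - c * q ^ 3 - c * d * q ^ 2 + c * d * q ^ 3 + b * q ^ 2 - b * q ^ 3 + b * d * q
      - 2 * b * d * q ^ 2 + b * d * q ^ 3 + b * c * q - 2 * b * c * q ^ 2 + b * c * q ^ 3 - b * c * d * q + 2 * b * c * d * q ^ 2
      - b * c * d * q ^ 3 + a * q ^ 2 - a * q ^ 3 + a * d * q - 2 * a * d * q ^ 2 + a * d * q ^ 3 + a * c * q - 2 * a * c * q ^ 2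
      + a * c * q ^ 3 - a * c * d * q + 2 * a * c * d * q ^ 2 - a * c * d * q ^ 3 - a * b * q ^ 2 + a * b * q ^ 3 - a * b * d * q
      + 2 * a * b * d * q ^ 2 - a * b * d * q ^ 3 - a * b * c * q + 2 * a * b * c * q ^ 2 - a * b * c * q ^ 3 + a * b * c * d * q
      - 2 * a * b * c * d * q ^ 2 + a * b * c * d * q ^ 3

/-- Chunk 1/2 of the certificate polynomial of the disjoint case (a polynomial with nonnegative coefficients in the
atoms `a, A = 1 − a, …, q, Q = 1 − q`). (this seat's certificate, bschramm/FK-BARRIER.md §10) -/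
def certDisj1 (a A b B c C d D q Q : ℝ) : ℝ :=
  A ^ 2 * b * B * c * C * D ^ 2 * q ^ 5 + A ^ 2 * b * B * c * C * d * D * q ^ 5 + A ^ 2 * b * B * c ^ 2 * D ^ 2 * q ^ 4 * Q
      + A ^ 2 * b * B * c ^ 2 * D ^ 2 * q ^ 5 + A ^ 2 * b * B * c ^ 2 * d * D * q ^ 4 * Q + A ^ 2 * b * B * c ^ 2 * d * D * q ^ 5
      + A ^ 2 * b ^ 2 * c * C * D ^ 2 * q ^ 4 * Q + A ^ 2 * b ^ 2 * c * C * D ^ 2 * q ^ 5 + A ^ 2 * b ^ 2 * c * C * d * D * q ^ 4 * Q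
      + A ^ 2 * b ^ 2 * c * C * d * D * q ^ 5 + A ^ 2 * b ^ 2 * c ^ 2 * d * D * q ^ 3 * Q ^ 2 + 2 * A ^ 2 * b ^ 2 * c ^ 2 * d * D * q ^ 4 * Q
      + A ^ 2 * b ^ 2 * c ^ 2 * d * D * q ^ 5 + a * A * B ^ 2 * C ^ 2 * d * D * q ^ 5 + a * A * B ^ 2 * C ^ 2 * d ^ 2 * q ^ 4 * Q
      + a * A * B ^ 2 * C ^ 2 * d ^ 2 * q ^ 5 + a * A * B ^ 2 * c * C * d * D * q ^ 5 + a * A * B ^ 2 * c * C * d ^ 2 * q ^ 4 * Q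
      + a * A * B ^ 2 * c * C * d ^ 2 * q ^ 5 + a * A * b * B * C ^ 2 * d * D * q ^ 5 + a * A * b * B * C ^ 2 * d ^ 2 * q ^ 4 * Q
      + a * A * b * B * C ^ 2 * d ^ 2 * q ^ 5 + a * A * b * B * c * C * D ^ 2 * q ^ 5 + 3 * a * A * b * B * c * C * d * D * q ^ 4 * Q
      + 4 * a * A * b * B * c * C * d * D * q ^ 5 + a * A * b * B * c * C * d ^ 2 * q ^ 4 * Q + a * A * b * B * c * C * d ^ 2 * q ^ 5
      + a * A * b * B * c ^ 2 * D ^ 2 * q ^ 4 * Q + a * A * b * B * c ^ 2 * D ^ 2 * q ^ 5 + a * A * b * B * c ^ 2 * d * D * q ^ 4 * Q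

/-- Chunk 1 of the disjoint certificate is nonnegative on nonnegative atoms. [folklore] -/
theorem certDisj1_nonneg {a A b B c C d D q Q : ℝ} (_ha : 0 ≤ a) (_hA : 0 ≤ A) (_hb : 0 ≤ b) (_hB : 0 ≤ B)
    (_hc : 0 ≤ c) (_hC : 0 ≤ C) (_hd : 0 ≤ d) (_hD : 0 ≤ D) (_hq : 0 ≤ q) (_hQ : 0 ≤ Q) :
    0 ≤ certDisj1 a A b B c C d D q Q := by
  unfold certDisj1; positivity

/-- Chunk 2/2 of the certificate polynomial of the disjoint case (a polynomial with nonnegative coefficients in the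
atoms `a, A = 1 − a, …, q, Q = 1 − q`). (this seat's certificate, bschramm/FK-BARRIER.md §10) -/
def certDisj2 (a A b B c C d D q Q : ℝ) : ℝ :=
  a * A * b * B * c ^ 2 * d * D * q ^ 5 + a * A * b ^ 2 * c * C * D ^ 2 * q ^ 4 * Q + a * A * b ^ 2 * c * C * D ^ 2 * q ^ 5
      + a * A * b ^ 2 * c * C * d * D * q ^ 4 * Q + a * A * b ^ 2 * c * C * d * D * q ^ 5 + a * A * b ^ 2 * c ^ 2 * D ^ 2 * q ^ 3 * Q ^ 2
      + 2 * a * A * b ^ 2 * c ^ 2 * D ^ 2 * q ^ 4 * Q + a * A * b ^ 2 * c ^ 2 * D ^ 2 * q ^ 5 + a * A * b ^ 2 * c ^ 2 * d * D * q ^ 3 * Q ^ 2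
      + 2 * a * A * b ^ 2 * c ^ 2 * d * D * q ^ 4 * Q + a * A * b ^ 2 * c ^ 2 * d * D * q ^ 5 + a ^ 2 * B ^ 2 * C ^ 2 * d * D * q ^ 4 * Q
      + a ^ 2 * B ^ 2 * C ^ 2 * d * D * q ^ 5 + a ^ 2 * B ^ 2 * c * C * d * D * q ^ 4 * Q + a ^ 2 * B ^ 2 * c * C * d * D * q ^ 5
      + a ^ 2 * B ^ 2 * c * C * d ^ 2 * q ^ 3 * Q ^ 2 + 2 * a ^ 2 * B ^ 2 * c * C * d ^ 2 * q ^ 4 * Q + a ^ 2 * B ^ 2 * c * C * d ^ 2 * q ^ 5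
      + a ^ 2 * b * B * C ^ 2 * d * D * q ^ 4 * Q + a ^ 2 * b * B * C ^ 2 * d * D * q ^ 5 + a ^ 2 * b * B * C ^ 2 * d ^ 2 * q ^ 3 * Q ^ 2
      + 2 * a ^ 2 * b * B * C ^ 2 * d ^ 2 * q ^ 4 * Q + a ^ 2 * b * B * C ^ 2 * d ^ 2 * q ^ 5 + a ^ 2 * b * B * c * C * d * D * q ^ 4 * Q
      + a ^ 2 * b * B * c * C * d * D * q ^ 5 + a ^ 2 * b * B * c * C * d ^ 2 * q ^ 3 * Q ^ 2 + 2 * a ^ 2 * b * B * c * C * d ^ 2 * q ^ 4 * Q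
      + a ^ 2 * b * B * c * C * d ^ 2 * q ^ 5

/-- Chunk 2 of the disjoint certificate is nonnegative on nonnegative atoms. [folklore] -/
theorem certDisj2_nonneg {a A b B c C d D q Q : ℝ} (_ha : 0 ≤ a) (_hA : 0 ≤ A) (_hb : 0 ≤ b) (_hB : 0 ≤ B)
    (_hc : 0 ≤ c) (_hC : 0 ≤ C) (_hd : 0 ≤ d) (_hD : 0 ≤ D) (_hq : 0 ≤ q) (_hQ : 0 ≤ Q) :
    0 ≤ certDisj2 a A b B c C d D q Q := by
  unfold certDisj2; positivity

/-- **The certificate polynomial of the disjoint case** in the atoms `a, A = 1 − a, …, q, Q = 1 − q`: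
`q³·(bcAD − adBC)²` plus a polynomial with nonnegative coefficients (Wagner: `ΔZ ≫ (y_b y_c − y_a y_d)²` in odds variables).
(this seat's certificate, bschramm/FK-BARRIER.md §10) [cite: Wagner2006, Ex. 5.2] -/
def certDisj (a A b B c C d D q Q : ℝ) : ℝ :=
  q ^ 3 * (b * c * A * D - a * d * B * C) ^ 2 + certDisj1 a A b B c C d D q Q + certDisj2 a A b B c C d D q Q

/-- The disjoint certificate is nonnegative on nonnegative atoms. [folklore] -/
theorem certDisj_nonneg {a A b B c C d D q Q : ℝ} (ha : 0 ≤ a) (hA : 0 ≤ A) (hb : 0 ≤ b) (hB : 0 ≤ B) (hc : 0 ≤ c)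
    (hC : 0 ≤ C) (hd : 0 ≤ d) (hD : 0 ≤ D) (hq : 0 ≤ q) (hQ : 0 ≤ Q) : 0 ≤ certDisj a A b B c C d D q Q := by
  unfold certDisj
  exact add_nonneg (add_nonneg (mul_nonneg (pow_nonneg hq 3) (sq_nonneg _)) (certDisj1_nonneg ha hA hb hB hc hC hd hD hq hQ))
      (certDisj2_nonneg ha hA hb hB hc hC hd hD hq hQ)

/-- **The bracket identity** (disjoint case): `S₀₀·Z₀₁ − S₀₁·Z₀₀` equals the certificate at `A = 1 − a, …, Q = 1 − q`.
(this seat's certificate, bschramm/FK-BARRIER.md §10) -/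
theorem bracketDisj_eq_cert (a b c d q : ℝ) :
    s00Disj a b c d q * z01Disj a b c d q - s01Disj a b c d q * z00Disj a b c d q =
      certDisj a (1 - a) b (1 - b) c (1 - c) d (1 - d) q (1 - q) := by
  unfold s00Disj z01Disj s01Disj z00Disj certDisj certDisj1 certDisj2
  ring

/-- **`K₄` is Potts–Rayleigh, disjoint pairs** (polynomial form): the bracket `S₀₀(0↮1)·Z₀₁ − S₀₁(0↮1)·Z₀₀` is
nonnegative for all parameters in `[0,1]` and `0 ≤ q ≤ 1`. [cite: Wagner2006, Ex. 5.2] -/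
theorem bracketDisj_nonneg {a b c d q : ℝ} (ha : 0 ≤ a) (ha1 : a ≤ 1) (hb : 0 ≤ b) (hb1 : b ≤ 1) (hc : 0 ≤ c)
    (hc1 : c ≤ 1) (hd : 0 ≤ d) (hd1 : d ≤ 1) (hq : 0 ≤ q) (hq1 : q ≤ 1) :
    0 ≤ s00Disj a b c d q * z01Disj a b c d q - s01Disj a b c d q * z00Disj a b c d q := by
  rw [bracketDisj_eq_cert]
  exact certDisj_nonneg ha (by linarith) hb (by linarith) hc (by linarith) hd (by linarith) hq (by linarith)

/-- The mass `S₀₀(0 ↮ 1)` of the adjacent case (`e = 01` absent, `f = 02` deleted; parameters `a, b, c, d` on `03, 12, 13, 23`). (transcription of this seat's exact enumeration, bschramm/FK-BARRIER.md §10) -/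
def s00Adj (a b c d q : ℝ) : ℝ :=
  q ^ 4 + d * q ^ 3 - d * q ^ 4 + c * q ^ 3 - c * q ^ 4 + c * d * q ^ 2 - 2 * c * d * q ^ 3 + c * d * q ^ 4 + b * q ^ 3
      - b * q ^ 4 + b * d * q ^ 2 - 2 * b * d * q ^ 3 + b * d * q ^ 4 + b * c * q ^ 2 - 2 * b * c * q ^ 3 + b * c * q ^ 4
      - 2 * b * c * d * q ^ 2 + 3 * b * c * d * q ^ 3 - b * c * d * q ^ 4 + a * q ^ 3 - a * q ^ 4 + a * d * q ^ 2 - 2 * a * d * q ^ 3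
      + a * d * q ^ 4 - 2 * a * c * q ^ 3 + a * c * q ^ 4 - 2 * a * c * d * q ^ 2 + 3 * a * c * d * q ^ 3 - a * c * d * q ^ 4
      + a * b * q ^ 2 - 2 * a * b * q ^ 3 + a * b * q ^ 4 - 3 * a * b * d * q ^ 2 + 3 * a * b * d * q ^ 3 - a * b * d * q ^ 4
      - 2 * a * b * c * q ^ 2 + 3 * a * b * c * q ^ 3 - a * b * c * q ^ 4 + 4 * a * b * c * d * q ^ 2 - 4 * a * b * c * d * q ^ 3
      + a * b * c * d * q ^ 4

/-- The partition function `Z₀₀` of the adjacent case (`e = 01` absent, `f = 02` deleted; parameters `a, b, c, d` on `03, 12, 13, 23`). (transcription of this seat's exact enumeration, bschramm/FK-BARRIER.md §10) -/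
def z00Adj (a b c d q : ℝ) : ℝ :=
  q ^ 4 + d * q ^ 3 - d * q ^ 4 + c * q ^ 3 - c * q ^ 4 + c * d * q ^ 2 - 2 * c * d * q ^ 3 + c * d * q ^ 4 + b * q ^ 3
      - b * q ^ 4 + b * d * q ^ 2 - 2 * b * d * q ^ 3 + b * d * q ^ 4 + b * c * q ^ 2 - 2 * b * c * q ^ 3 + b * c * q ^ 4
      - 2 * b * c * d * q ^ 2 + 3 * b * c * d * q ^ 3 - b * c * d * q ^ 4 + a * q ^ 3 - a * q ^ 4 + a * d * q ^ 2 - 2 * a * d * q ^ 3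
      + a * d * q ^ 4 + a * c * q ^ 2 - 2 * a * c * q ^ 3 + a * c * q ^ 4 + a * c * d * q - 3 * a * c * d * q ^ 2 + 3 * a * c * d * q ^ 3
      - a * c * d * q ^ 4 + a * b * q ^ 2 - 2 * a * b * q ^ 3 + a * b * q ^ 4 + a * b * d * q - 3 * a * b * d * q ^ 2
      + 3 * a * b * d * q ^ 3 - a * b * d * q ^ 4 + a * b * c * q - 3 * a * b * c * q ^ 2 + 3 * a * b * c * q ^ 3 - a * b * c * q ^ 4
      - 2 * a * b * c * d * q + 5 * a * b * c * d * q ^ 2 - 4 * a * b * c * d * q ^ 3 + a * b * c * d * q ^ 4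

/-- The mass `S₀₁(0 ↮ 1)` of the adjacent case (`e = 01` absent, `f = 02` contracted, i.e. parameter 1; parameters `a, b, c, d` on `03, 12, 13, 23`). (transcription of this seat's exact enumeration, bschramm/FK-BARRIER.md §10) -/
def s01Adj (a b c d q : ℝ) : ℝ :=
  q ^ 3 + d * q ^ 2 - d * q ^ 3 + c * q ^ 2 - c * q ^ 3 - 2 * c * d * q ^ 2 + c * d * q ^ 3 - b * q ^ 3 - b * d * q ^ 2
      + b * d * q ^ 3 - b * c * q ^ 2 + b * c * q ^ 3 + 2 * b * c * d * q ^ 2 - b * c * d * q ^ 3 + a * q ^ 2 - a * q ^ 3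
      - a * d * q ^ 2 + a * d * q ^ 3 - 2 * a * c * q ^ 2 + a * c * q ^ 3 + 2 * a * c * d * q ^ 2 - a * c * d * q ^ 3
      - a * b * q ^ 2 + a * b * q ^ 3 + a * b * d * q ^ 2 - a * b * d * q ^ 3 + 2 * a * b * c * q ^ 2 - a * b * c * q ^ 3
      - 2 * a * b * c * d * q ^ 2 + a * b * c * d * q ^ 3

/-- The partition function `Z₀₁` of the adjacent case (`e = 01` absent, `f = 02` contracted; parameters `a, b, c, d` on `03, 12, 13, 23`). (transcription of this seat's exact enumeration, bschramm/FK-BARRIER.md §10) -/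
def z01Adj (a b c d q : ℝ) : ℝ :=
  q ^ 3 + d * q ^ 2 - d * q ^ 3 + c * q ^ 2 - c * q ^ 3 + c * d * q - 2 * c * d * q ^ 2 + c * d * q ^ 3 + b * q ^ 2 - b * q ^ 3
      + b * d * q - 2 * b * d * q ^ 2 + b * d * q ^ 3 + b * c * q - 2 * b * c * q ^ 2 + b * c * q ^ 3 - 2 * b * c * d * q
      + 3 * b * c * d * q ^ 2 - b * c * d * q ^ 3 + a * q ^ 2 - a * q ^ 3 - a * d * q ^ 2 + a * d * q ^ 3 + a * c * q
      - 2 * a * c * q ^ 2 + a * c * q ^ 3 - a * c * d * q + 2 * a * c * d * q ^ 2 - a * c * d * q ^ 3 + a * b * q - 2 * a * b * q ^ 2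
      + a * b * q ^ 3 - a * b * d * q + 2 * a * b * d * q ^ 2 - a * b * d * q ^ 3 - 2 * a * b * c * q + 3 * a * b * c * q ^ 2
      - a * b * c * q ^ 3 + 2 * a * b * c * d * q - 3 * a * b * c * d * q ^ 2 + a * b * c * d * q ^ 3

/-- Chunk 1/6 of the certificate polynomial of the adjacent case (a polynomial with nonnegative coefficients in the
atoms `a, A = 1 − a, …, q, Q = 1 − q`). (this seat's certificate, bschramm/FK-BARRIER.md §10) -/
def certAdj1 (_a A b B c C d D q Q : ℝ) : ℝ :=
  A ^ 2 * B ^ 2 * c * C * d * D * q ^ 5 * Q + A ^ 2 * B ^ 2 * c * C * d * D * q ^ 6 + A ^ 2 * B ^ 2 * c * C * d ^ 2 * q ^ 4 * Q ^ 2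
      + 2 * A ^ 2 * B ^ 2 * c * C * d ^ 2 * q ^ 5 * Q + A ^ 2 * B ^ 2 * c * C * d ^ 2 * q ^ 6 + A ^ 2 * B ^ 2 * c ^ 2 * d * D * q ^ 4 * Q ^ 2
      + 2 * A ^ 2 * B ^ 2 * c ^ 2 * d * D * q ^ 5 * Q + A ^ 2 * B ^ 2 * c ^ 2 * d * D * q ^ 6 + A ^ 2 * B ^ 2 * c ^ 2 * d ^ 2 * q ^ 3 * Q ^ 3
      + 3 * A ^ 2 * B ^ 2 * c ^ 2 * d ^ 2 * q ^ 4 * Q ^ 2 + 3 * A ^ 2 * B ^ 2 * c ^ 2 * d ^ 2 * q ^ 5 * Q + A ^ 2 * B ^ 2 * c ^ 2 * d ^ 2 * q ^ 6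
      + A ^ 2 * b * B * C ^ 2 * D ^ 2 * q ^ 6 + 2 * A ^ 2 * b * B * C ^ 2 * d * D * q ^ 5 * Q + 2 * A ^ 2 * b * B * C ^ 2 * d * D * q ^ 6
      + A ^ 2 * b * B * C ^ 2 * d ^ 2 * q ^ 4 * Q ^ 2 + 2 * A ^ 2 * b * B * C ^ 2 * d ^ 2 * q ^ 5 * Q + A ^ 2 * b * B * C ^ 2 * d ^ 2 * q ^ 6
      + 2 * A ^ 2 * b * B * c * C * D ^ 2 * q ^ 5 * Q + 2 * A ^ 2 * b * B * c * C * D ^ 2 * q ^ 6 + 4 * A ^ 2 * b * B * c * C * d * D * q ^ 4 * Q ^ 2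
      + 9 * A ^ 2 * b * B * c * C * d * D * q ^ 5 * Q + 5 * A ^ 2 * b * B * c * C * d * D * q ^ 6 + 2 * A ^ 2 * b * B * c * C * d ^ 2 * q ^ 3 * Q ^ 3
      + 7 * A ^ 2 * b * B * c * C * d ^ 2 * q ^ 4 * Q ^ 2 + 8 * A ^ 2 * b * B * c * C * d ^ 2 * q ^ 5 * Q + 3 * A ^ 2 * b * B * c * C * d ^ 2 * q ^ 6
      + A ^ 2 * b * B * c ^ 2 * D ^ 2 * q ^ 4 * Q ^ 2 + 2 * A ^ 2 * b * B * c ^ 2 * D ^ 2 * q ^ 5 * Q + A ^ 2 * b * B * c ^ 2 * D ^ 2 * q ^ 6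

/-- Chunk 1 of the adjacent certificate is nonnegative on nonnegative atoms. [folklore] -/
theorem certAdj1_nonneg {a A b B c C d D q Q : ℝ} (_ha : 0 ≤ a) (_hA : 0 ≤ A) (_hb : 0 ≤ b) (_hB : 0 ≤ B)
    (_hc : 0 ≤ c) (_hC : 0 ≤ C) (_hd : 0 ≤ d) (_hD : 0 ≤ D) (_hq : 0 ≤ q) (_hQ : 0 ≤ Q) :
    0 ≤ certAdj1 a A b B c C d D q Q := by
  unfold certAdj1; positivity

/-- Chunk 2/6 of the certificate polynomial of the adjacent case (a polynomial with nonnegative coefficients in the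
atoms `a, A = 1 − a, …, q, Q = 1 − q`). (this seat's certificate, bschramm/FK-BARRIER.md §10) -/
def certAdj2 (_a A b B c C d D q Q : ℝ) : ℝ :=
  2 * A ^ 2 * b * B * c ^ 2 * d * D * q ^ 3 * Q ^ 3 + 7 * A ^ 2 * b * B * c ^ 2 * d * D * q ^ 4 * Q ^ 2 + 8 * A ^ 2 * b * B * c ^ 2 * d * D * q ^ 5 * Q
      + 3 * A ^ 2 * b * B * c ^ 2 * d * D * q ^ 6 + 2 * A ^ 2 * b * B * c ^ 2 * d ^ 2 * q ^ 3 * Q ^ 3 + 6 * A ^ 2 * b * B * c ^ 2 * d ^ 2 * q ^ 4 * Q ^ 2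
      + 6 * A ^ 2 * b * B * c ^ 2 * d ^ 2 * q ^ 5 * Q + 2 * A ^ 2 * b * B * c ^ 2 * d ^ 2 * q ^ 6 + A ^ 2 * b ^ 2 * C ^ 2 * D ^ 2 * q ^ 5 * Q
      + A ^ 2 * b ^ 2 * C ^ 2 * D ^ 2 * q ^ 6 + 2 * A ^ 2 * b ^ 2 * C ^ 2 * d * D * q ^ 4 * Q ^ 2 + 4 * A ^ 2 * b ^ 2 * C ^ 2 * d * D * q ^ 5 * Q
      + 2 * A ^ 2 * b ^ 2 * C ^ 2 * d * D * q ^ 6 + A ^ 2 * b ^ 2 * C ^ 2 * d ^ 2 * q ^ 3 * Q ^ 3 + 3 * A ^ 2 * b ^ 2 * C ^ 2 * d ^ 2 * q ^ 4 * Q ^ 2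
      + 3 * A ^ 2 * b ^ 2 * C ^ 2 * d ^ 2 * q ^ 5 * Q + A ^ 2 * b ^ 2 * C ^ 2 * d ^ 2 * q ^ 6 + 2 * A ^ 2 * b ^ 2 * c * C * D ^ 2 * q ^ 4 * Q ^ 2
      + 4 * A ^ 2 * b ^ 2 * c * C * D ^ 2 * q ^ 5 * Q + 2 * A ^ 2 * b ^ 2 * c * C * D ^ 2 * q ^ 6 + 2 * A ^ 2 * b ^ 2 * c * C * d * D * q ^ 3 * Q ^ 3
      + 8 * A ^ 2 * b ^ 2 * c * C * d * D * q ^ 4 * Q ^ 2 + 10 * A ^ 2 * b ^ 2 * c * C * d * D * q ^ 5 * Q + 4 * A ^ 2 * b ^ 2 * c * C * d * D * q ^ 6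
      + 2 * A ^ 2 * b ^ 2 * c * C * d ^ 2 * q ^ 3 * Q ^ 3 + 6 * A ^ 2 * b ^ 2 * c * C * d ^ 2 * q ^ 4 * Q ^ 2 + 6 * A ^ 2 * b ^ 2 * c * C * d ^ 2 * q ^ 5 * Q
      + 2 * A ^ 2 * b ^ 2 * c * C * d ^ 2 * q ^ 6 + A ^ 2 * b ^ 2 * c ^ 2 * D ^ 2 * q ^ 3 * Q ^ 3 + 3 * A ^ 2 * b ^ 2 * c ^ 2 * D ^ 2 * q ^ 4 * Q ^ 2

/-- Chunk 2 of the adjacent certificate is nonnegative on nonnegative atoms. [folklore] -/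
theorem certAdj2_nonneg {a A b B c C d D q Q : ℝ} (_ha : 0 ≤ a) (_hA : 0 ≤ A) (_hb : 0 ≤ b) (_hB : 0 ≤ B)
    (_hc : 0 ≤ c) (_hC : 0 ≤ C) (_hd : 0 ≤ d) (_hD : 0 ≤ D) (_hq : 0 ≤ q) (_hQ : 0 ≤ Q) :
    0 ≤ certAdj2 a A b B c C d D q Q := by
  unfold certAdj2; positivity

/-- Chunk 3/6 of the certificate polynomial of the adjacent case (a polynomial with nonnegative coefficients in the
atoms `a, A = 1 − a, …, q, Q = 1 − q`). (this seat's certificate, bschramm/FK-BARRIER.md §10) -/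
def certAdj3 (a A b B c C d D q Q : ℝ) : ℝ :=
  3 * A ^ 2 * b ^ 2 * c ^ 2 * D ^ 2 * q ^ 5 * Q + A ^ 2 * b ^ 2 * c ^ 2 * D ^ 2 * q ^ 6 + 2 * A ^ 2 * b ^ 2 * c ^ 2 * d * D * q ^ 3 * Q ^ 3
      + 6 * A ^ 2 * b ^ 2 * c ^ 2 * d * D * q ^ 4 * Q ^ 2 + 6 * A ^ 2 * b ^ 2 * c ^ 2 * d * D * q ^ 5 * Q + 2 * A ^ 2 * b ^ 2 * c ^ 2 * d * D * q ^ 6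
      + A ^ 2 * b ^ 2 * c ^ 2 * d ^ 2 * q ^ 3 * Q ^ 3 + 3 * A ^ 2 * b ^ 2 * c ^ 2 * d ^ 2 * q ^ 4 * Q ^ 2 + 3 * A ^ 2 * b ^ 2 * c ^ 2 * d ^ 2 * q ^ 5 * Q
      + A ^ 2 * b ^ 2 * c ^ 2 * d ^ 2 * q ^ 6 + a * A * B ^ 2 * c * C * d * D * q ^ 5 * Q + a * A * B ^ 2 * c * C * d * D * q ^ 6
      + a * A * B ^ 2 * c * C * d ^ 2 * q ^ 4 * Q ^ 2 + 2 * a * A * B ^ 2 * c * C * d ^ 2 * q ^ 5 * Q + a * A * B ^ 2 * c * C * d ^ 2 * q ^ 6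
      + a * A * B ^ 2 * c ^ 2 * d * D * q ^ 4 * Q ^ 2 + 2 * a * A * B ^ 2 * c ^ 2 * d * D * q ^ 5 * Q + a * A * B ^ 2 * c ^ 2 * d * D * q ^ 6
      + a * A * B ^ 2 * c ^ 2 * d ^ 2 * q ^ 3 * Q ^ 3 + 3 * a * A * B ^ 2 * c ^ 2 * d ^ 2 * q ^ 4 * Q ^ 2 + 3 * a * A * B ^ 2 * c ^ 2 * d ^ 2 * q ^ 5 * Q
      + a * A * B ^ 2 * c ^ 2 * d ^ 2 * q ^ 6 + 2 * a * A * b * B * C ^ 2 * D ^ 2 * q ^ 5 * Q + 2 * a * A * b * B * C ^ 2 * D ^ 2 * q ^ 6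
      + 2 * a * A * b * B * C ^ 2 * d * D * q ^ 4 * Q ^ 2 + 5 * a * A * b * B * C ^ 2 * d * D * q ^ 5 * Q + 3 * a * A * b * B * C ^ 2 * d * D * q ^ 6
      + a * A * b * B * C ^ 2 * d ^ 2 * q ^ 4 * Q ^ 2 + 2 * a * A * b * B * C ^ 2 * d ^ 2 * q ^ 5 * Q + a * A * b * B * C ^ 2 * d ^ 2 * q ^ 6

/-- Chunk 3 of the adjacent certificate is nonnegative on nonnegative atoms. [folklore] -/
theorem certAdj3_nonneg {a A b B c C d D q Q : ℝ} (_ha : 0 ≤ a) (_hA : 0 ≤ A) (_hb : 0 ≤ b) (_hB : 0 ≤ B)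
    (_hc : 0 ≤ c) (_hC : 0 ≤ C) (_hd : 0 ≤ d) (_hD : 0 ≤ D) (_hq : 0 ≤ q) (_hQ : 0 ≤ Q) :
    0 ≤ certAdj3 a A b B c C d D q Q := by
  unfold certAdj3; positivity

/-- Chunk 4/6 of the certificate polynomial of the adjacent case (a polynomial with nonnegative coefficients in the
atoms `a, A = 1 − a, …, q, Q = 1 − q`). (this seat's certificate, bschramm/FK-BARRIER.md §10) -/
def certAdj4 (a A b B c C d D q Q : ℝ) : ℝ :=
  2 * a * A * b * B * c * C * D ^ 2 * q ^ 4 * Q ^ 2 + 5 * a * A * b * B * c * C * D ^ 2 * q ^ 5 * Q + 3 * a * A * b * B * c * C * D ^ 2 * q ^ 6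
      + 2 * a * A * b * B * c * C * d * D * q ^ 3 * Q ^ 3 + 9 * a * A * b * B * c * C * d * D * q ^ 4 * Q ^ 2 + 13 * a * A * b * B * c * C * d * D * q ^ 5 * Q
      + 6 * a * A * b * B * c * C * d * D * q ^ 6 + 2 * a * A * b * B * c * C * d ^ 2 * q ^ 3 * Q ^ 3 + 7 * a * A * b * B * c * C * d ^ 2 * q ^ 4 * Q ^ 2
      + 8 * a * A * b * B * c * C * d ^ 2 * q ^ 5 * Q + 3 * a * A * b * B * c * C * d ^ 2 * q ^ 6 + a * A * b * B * c ^ 2 * D ^ 2 * q ^ 4 * Q ^ 2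
      + 2 * a * A * b * B * c ^ 2 * D ^ 2 * q ^ 5 * Q + a * A * b * B * c ^ 2 * D ^ 2 * q ^ 6 + 2 * a * A * b * B * c ^ 2 * d * D * q ^ 3 * Q ^ 3
      + 7 * a * A * b * B * c ^ 2 * d * D * q ^ 4 * Q ^ 2 + 8 * a * A * b * B * c ^ 2 * d * D * q ^ 5 * Q + 3 * a * A * b * B * c ^ 2 * d * D * q ^ 6
      + 2 * a * A * b * B * c ^ 2 * d ^ 2 * q ^ 3 * Q ^ 3 + 6 * a * A * b * B * c ^ 2 * d ^ 2 * q ^ 4 * Q ^ 2 + 6 * a * A * b * B * c ^ 2 * d ^ 2 * q ^ 5 * Q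
      + 2 * a * A * b * B * c ^ 2 * d ^ 2 * q ^ 6 + 2 * a * A * b ^ 2 * C ^ 2 * D ^ 2 * q ^ 4 * Q ^ 2 + 4 * a * A * b ^ 2 * C ^ 2 * D ^ 2 * q ^ 5 * Q
      + 2 * a * A * b ^ 2 * C ^ 2 * D ^ 2 * q ^ 6 + 2 * a * A * b ^ 2 * C ^ 2 * d * D * q ^ 3 * Q ^ 3 + 7 * a * A * b ^ 2 * C ^ 2 * d * D * q ^ 4 * Q ^ 2
      + 8 * a * A * b ^ 2 * C ^ 2 * d * D * q ^ 5 * Q + 3 * a * A * b ^ 2 * C ^ 2 * d * D * q ^ 6 + a * A * b ^ 2 * C ^ 2 * d ^ 2 * q ^ 3 * Q ^ 3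

/-- Chunk 4 of the adjacent certificate is nonnegative on nonnegative atoms. [folklore] -/
theorem certAdj4_nonneg {a A b B c C d D q Q : ℝ} (_ha : 0 ≤ a) (_hA : 0 ≤ A) (_hb : 0 ≤ b) (_hB : 0 ≤ B)
    (_hc : 0 ≤ c) (_hC : 0 ≤ C) (_hd : 0 ≤ d) (_hD : 0 ≤ D) (_hq : 0 ≤ q) (_hQ : 0 ≤ Q) :
    0 ≤ certAdj4 a A b B c C d D q Q := by
  unfold certAdj4; positivity

/-- Chunk 5/6 of the certificate polynomial of the adjacent case (a polynomial with nonnegative coefficients in the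
atoms `a, A = 1 − a, …, q, Q = 1 − q`). (this seat's certificate, bschramm/FK-BARRIER.md §10) -/
def certAdj5 (a A b B c C d D q Q : ℝ) : ℝ :=
  3 * a * A * b ^ 2 * C ^ 2 * d ^ 2 * q ^ 4 * Q ^ 2 + 3 * a * A * b ^ 2 * C ^ 2 * d ^ 2 * q ^ 5 * Q + a * A * b ^ 2 * C ^ 2 * d ^ 2 * q ^ 6
      + 2 * a * A * b ^ 2 * c * C * D ^ 2 * q ^ 3 * Q ^ 3 + 7 * a * A * b ^ 2 * c * C * D ^ 2 * q ^ 4 * Q ^ 2 + 8 * a * A * b ^ 2 * c * C * D ^ 2 * q ^ 5 * Q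
      + 3 * a * A * b ^ 2 * c * C * D ^ 2 * q ^ 6 + 4 * a * A * b ^ 2 * c * C * d * D * q ^ 3 * Q ^ 3 + 13 * a * A * b ^ 2 * c * C * d * D * q ^ 4 * Q ^ 2
      + 14 * a * A * b ^ 2 * c * C * d * D * q ^ 5 * Q + 5 * a * A * b ^ 2 * c * C * d * D * q ^ 6 + 2 * a * A * b ^ 2 * c * C * d ^ 2 * q ^ 3 * Q ^ 3
      + 6 * a * A * b ^ 2 * c * C * d ^ 2 * q ^ 4 * Q ^ 2 + 6 * a * A * b ^ 2 * c * C * d ^ 2 * q ^ 5 * Q + 2 * a * A * b ^ 2 * c * C * d ^ 2 * q ^ 6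
      + a * A * b ^ 2 * c ^ 2 * D ^ 2 * q ^ 3 * Q ^ 3 + 3 * a * A * b ^ 2 * c ^ 2 * D ^ 2 * q ^ 4 * Q ^ 2 + 3 * a * A * b ^ 2 * c ^ 2 * D ^ 2 * q ^ 5 * Q
      + a * A * b ^ 2 * c ^ 2 * D ^ 2 * q ^ 6 + 2 * a * A * b ^ 2 * c ^ 2 * d * D * q ^ 3 * Q ^ 3 + 6 * a * A * b ^ 2 * c ^ 2 * d * D * q ^ 4 * Q ^ 2
      + 6 * a * A * b ^ 2 * c ^ 2 * d * D * q ^ 5 * Q + 2 * a * A * b ^ 2 * c ^ 2 * d * D * q ^ 6 + a * A * b ^ 2 * c ^ 2 * d ^ 2 * q ^ 3 * Q ^ 3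
      + 3 * a * A * b ^ 2 * c ^ 2 * d ^ 2 * q ^ 4 * Q ^ 2 + 3 * a * A * b ^ 2 * c ^ 2 * d ^ 2 * q ^ 5 * Q + a * A * b ^ 2 * c ^ 2 * d ^ 2 * q ^ 6
      + a ^ 2 * b * B * C ^ 2 * D ^ 2 * q ^ 4 * Q ^ 2 + 2 * a ^ 2 * b * B * C ^ 2 * D ^ 2 * q ^ 5 * Q + a ^ 2 * b * B * C ^ 2 * D ^ 2 * q ^ 6

/-- Chunk 5 of the adjacent certificate is nonnegative on nonnegative atoms. [folklore] -/
theorem certAdj5_nonneg {a A b B c C d D q Q : ℝ} (_ha : 0 ≤ a) (_hA : 0 ≤ A) (_hb : 0 ≤ b) (_hB : 0 ≤ B)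
    (_hc : 0 ≤ c) (_hC : 0 ≤ C) (_hd : 0 ≤ d) (_hD : 0 ≤ D) (_hq : 0 ≤ q) (_hQ : 0 ≤ Q) :
    0 ≤ certAdj5 a A b B c C d D q Q := by
  unfold certAdj5; positivity

/-- Chunk 6/6 of the certificate polynomial of the adjacent case (a polynomial with nonnegative coefficients in the
atoms `a, A = 1 − a, …, q, Q = 1 − q`). (this seat's certificate, bschramm/FK-BARRIER.md §10) -/
def certAdj6 (a _A b B c C d D q Q : ℝ) : ℝ :=
  a ^ 2 * b * B * C ^ 2 * d * D * q ^ 4 * Q ^ 2 + 2 * a ^ 2 * b * B * C ^ 2 * d * D * q ^ 5 * Q + a ^ 2 * b * B * C ^ 2 * d * D * q ^ 6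
      + a ^ 2 * b * B * c * C * D ^ 2 * q ^ 4 * Q ^ 2 + 2 * a ^ 2 * b * B * c * C * D ^ 2 * q ^ 5 * Q + a ^ 2 * b * B * c * C * D ^ 2 * q ^ 6
      + a ^ 2 * b * B * c * C * d * D * q ^ 4 * Q ^ 2 + 2 * a ^ 2 * b * B * c * C * d * D * q ^ 5 * Q + a ^ 2 * b * B * c * C * d * D * q ^ 6
      + a ^ 2 * b ^ 2 * C ^ 2 * D ^ 2 * q ^ 3 * Q ^ 3 + 3 * a ^ 2 * b ^ 2 * C ^ 2 * D ^ 2 * q ^ 4 * Q ^ 2 + 3 * a ^ 2 * b ^ 2 * C ^ 2 * D ^ 2 * q ^ 5 * Q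
      + a ^ 2 * b ^ 2 * C ^ 2 * D ^ 2 * q ^ 6 + a ^ 2 * b ^ 2 * C ^ 2 * d * D * q ^ 3 * Q ^ 3 + 3 * a ^ 2 * b ^ 2 * C ^ 2 * d * D * q ^ 4 * Q ^ 2
      + 3 * a ^ 2 * b ^ 2 * C ^ 2 * d * D * q ^ 5 * Q + a ^ 2 * b ^ 2 * C ^ 2 * d * D * q ^ 6 + a ^ 2 * b ^ 2 * c * C * D ^ 2 * q ^ 3 * Q ^ 3
      + 3 * a ^ 2 * b ^ 2 * c * C * D ^ 2 * q ^ 4 * Q ^ 2 + 3 * a ^ 2 * b ^ 2 * c * C * D ^ 2 * q ^ 5 * Q + a ^ 2 * b ^ 2 * c * C * D ^ 2 * q ^ 6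
      + a ^ 2 * b ^ 2 * c * C * d * D * q ^ 3 * Q ^ 3 + 3 * a ^ 2 * b ^ 2 * c * C * d * D * q ^ 4 * Q ^ 2 + 3 * a ^ 2 * b ^ 2 * c * C * d * D * q ^ 5 * Q
      + a ^ 2 * b ^ 2 * c * C * d * D * q ^ 6

/-- Chunk 6 of the adjacent certificate is nonnegative on nonnegative atoms. [folklore] -/
theorem certAdj6_nonneg {a A b B c C d D q Q : ℝ} (_ha : 0 ≤ a) (_hA : 0 ≤ A) (_hb : 0 ≤ b) (_hB : 0 ≤ B)
    (_hc : 0 ≤ c) (_hC : 0 ≤ C) (_hd : 0 ≤ d) (_hD : 0 ≤ D) (_hq : 0 ≤ q) (_hQ : 0 ≤ Q) :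
    0 ≤ certAdj6 a A b B c C d D q Q := by
  unfold certAdj6; positivity

/-- **The certificate polynomial of the adjacent case** in the atoms `a, A = 1 − a, …, q, Q = 1 − q`:
a polynomial with nonnegative coefficients (the adjacent case is coefficientwise nonnegative in the odds variables).
(this seat's certificate, bschramm/FK-BARRIER.md §10) [cite: Wagner2006, Ex. 5.2] -/
def certAdj (a A b B c C d D q Q : ℝ) : ℝ :=
  certAdj1 a A b B c C d D q Q + certAdj2 a A b B c C d D q Q + certAdj3 a A b B c C d D q Q + certAdj4 a A b B c C d D q Q
      + certAdj5 a A b B c C d D q Q + certAdj6 a A b B c C d D q Q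

/-- The adjacent certificate is nonnegative on nonnegative atoms. [folklore] -/
theorem certAdj_nonneg {a A b B c C d D q Q : ℝ} (ha : 0 ≤ a) (hA : 0 ≤ A) (hb : 0 ≤ b) (hB : 0 ≤ B) (hc : 0 ≤ c)
    (hC : 0 ≤ C) (hd : 0 ≤ d) (hD : 0 ≤ D) (hq : 0 ≤ q) (hQ : 0 ≤ Q) : 0 ≤ certAdj a A b B c C d D q Q := by
  unfold certAdj
  exact add_nonneg (add_nonneg (add_nonneg (add_nonneg (add_nonneg (certAdj1_nonneg ha hA hb hB hc hC hd hD hq hQ)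
      (certAdj2_nonneg ha hA hb hB hc hC hd hD hq hQ)) (certAdj3_nonneg ha hA hb hB hc hC hd hD hq hQ))
      (certAdj4_nonneg ha hA hb hB hc hC hd hD hq hQ)) (certAdj5_nonneg ha hA hb hB hc hC hd hD hq hQ))
      (certAdj6_nonneg ha hA hb hB hc hC hd hD hq hQ)

/-- **The bracket identity** (adjacent case): `S₀₀·Z₀₁ − S₀₁·Z₀₀` equals the certificate at `A = 1 − a, …, Q = 1 − q`.
(this seat's certificate, bschramm/FK-BARRIER.md §10) -/
theorem bracketAdj_eq_cert (a b c d q : ℝ) :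
    s00Adj a b c d q * z01Adj a b c d q - s01Adj a b c d q * z00Adj a b c d q =
      certAdj a (1 - a) b (1 - b) c (1 - c) d (1 - d) q (1 - q) := by
  unfold s00Adj z01Adj s01Adj z00Adj certAdj certAdj1 certAdj2 certAdj3 certAdj4 certAdj5 certAdj6
  ring

/-- **`K₄` is Potts–Rayleigh, adjacent pairs** (polynomial form): the bracket `S₀₀(0↮1)·Z₀₁ − S₀₁(0↮1)·Z₀₀` is
nonnegative for all parameters in `[0,1]` and `0 ≤ q ≤ 1`. [cite: Wagner2006, Ex. 5.2] -/
theorem bracketAdj_nonneg {a b c d q : ℝ} (ha : 0 ≤ a) (ha1 : a ≤ 1) (hb : 0 ≤ b) (hb1 : b ≤ 1) (hc : 0 ≤ c)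
    (hc1 : c ≤ 1) (hd : 0 ≤ d) (hd1 : d ≤ 1) (hq : 0 ≤ q) (hq1 : q ≤ 1) :
    0 ≤ s00Adj a b c d q * z01Adj a b c d q - s01Adj a b c d q * z00Adj a b c d q := by
  rw [bracketAdj_eq_cert]
  exact certAdj_nonneg ha (by linarith) hb (by linarith) hc (by linarith) hd (by linarith) hq (by linarith)

end RayleighK4

end FK

end Summit.CriticalPhenomena.PercolationContinuityZ3.Theorems

end
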